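import Summits.ValiantsHypothesis.ValiantsHypothesis.Theorems.KPlusLogSqLawDefinitePivotZoneRay
import Summits.ValiantsHypothesis.ValiantsHypothesis.Theorems.KPlusLogSqLawDefinitePivotUnfolding

/-!
# Route «KPlusLogSqLaw», crux `WeakLifting` (stmt-ValiantsHypothesis-19561) — α register / Lift line:
# the two EXTREME eigenvalue sheets of a definite-pivot pencil carry at most four zeros (all sizes, all letter counts)

HONEST FRAMING.  Helper file (`--supports stmt-ValiantsHypothesis-19561 --as helper`), seat val-sym-lift-p2 (g12), cell `pub-symmetroid`,
2026-08-28; assembles the zone lemmas of `…DefinitePivotZone` (p602968) and `…DefinitePivotZoneRay` into ROOT COUNTS.  Elementary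
(convexity + «a nonzero polynomial has finitely many roots»); nothing here bears on `WeakLifting`, `TropicalB`, Conjecture B, Door-A,
`MatrixDescartes` (stmt-ValiantsHypothesis-18050) or VP ≠ VNP.

SETTING.  `F(X) = ∑ₖ X^{dₖ} • Pₖ − X^e • N` with `Pₖ ⪰ 0` real positive semidefinite and `N` ANY real symmetric letter (the pivot); `det F ≢ 0`.
A positive zero `x` of `det F` is on the BOTTOM sheet if `F(x) ⪯ 0` (the pivot dominates: the vanishing eigenvalue is the top one of `F(x)`)
and on the TOP sheet if `F(x) ⪰ 0`.
* `card_roots_negSemidef_le_two` — **at most TWO positive zeros of `det F` have `F(x) ⪯ 0`.**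
* `card_roots_posSemidef_le_two_of_negDef` — **if `F(x₀) ≺ 0` at some `x₀ > 0`, at most TWO positive zeros of `det F` have `F(x) ⪰ 0`.**
So a pencil of the definite-pivot sector that is pivot-dominated somewhere has at most four zeros on its extreme sheets, for every size `m` and
every number `K` of PSD letters — the zeros in excess of four (and all of the rank law's content, memo RANK-LAW-liftp2g12.md) live on the
middle sheets.  Mechanism: `{x : F(x) ⪯ 0}` is an interval and `{F ≺ 0}` an interval inside it; three bottom-sheet zeros `p < q < r` would put
`[p,q]` or `[q,r]` inside `{F ⪯ 0} ∖ {F ≺ 0}`, where `det F` vanishes identically — infinitely many roots.  Dually with the rays of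
`…ZoneRay` for the top sheet.  Also proved here: the non-strict zone lemmas (`posSemidef_pivotSub_of_mem_Icc`,
`posSemidef_pencil_of_negDef_left/right`).

[folklore] Convexity of Laurent polynomials with non-negative coefficients; finiteness of the root set of a nonzero polynomial.
-/

-- `Summit.ValiantsHypothesis.ValiantsHypothesis.…` repeats a component by the D-0017 layout
-- (single-conjunct summit), which the `dupNamespace` linter flags; the name is mandated.
set_option linter.dupNamespace false
set_option autoImplicit false

namespace Summit.ValiantsHypothesis.ValiantsHypothesis.Theorems.KPlusLogSqLaw.DefinitePivot

open Matrix Polynomial Finset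
open scoped BigOperators

variable {m K : ℕ}

/-! ## 1. Non-strict zone lemmas -/

/-- the CLOSED negative zone `{x : ∑ x^{dₖ}Pₖ ⪯ x^e N}` is an interval. [folklore] -/
theorem posSemidef_pivotSub_of_mem_Icc (P : Fin K → Matrix (Fin m) (Fin m) ℝ) (hP : ∀ k, (P k).PosSemidef)
    (N : Matrix (Fin m) (Fin m) ℝ) (hN : N.IsSymm) (d : Fin K → ℕ) (e : ℕ) {x y z : ℝ}
    (hx : 0 < x) (hxy : x ≤ y) (hyz : y ≤ z)
    (hFx : (x ^ e • N - ∑ k, x ^ d k • P k).PosSemidef) (hFz : (z ^ e • N - ∑ k, z ^ d k • P k).PosSemidef) :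
    (y ^ e • N - ∑ k, y ^ d k • P k).PosSemidef := by
  have hy : 0 < y := lt_of_lt_of_le hx hxy
  have hz : 0 < z := lt_of_lt_of_le hy hyz
  refine PosSemidef.of_dotProduct_mulVec_nonneg (isHermitian_pivotSub P (fun k => (hP k).1) N hN d e y) fun u => ?_
  have hxq := hFx.dotProduct_mulVec_nonneg u
  have hzq := hFz.dotProduct_mulVec_nonneg u
  rw [star_trivial] at hxq hzq ⊢
  rw [dotProduct_pivotSub_mulVec] at hxq hzq ⊢
  set a : ℝ := u ⬝ᵥ (N *ᵥ u) with ha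
  set b : Fin K → ℝ := fun k => u ⬝ᵥ (P k *ᵥ u) with hb
  have hb0 : ∀ k, 0 ≤ b k := fun k => by
    have h := (hP k).dotProduct_mulVec_nonneg u
    rwa [star_trivial] at h
  have hg : ∀ s : ℝ, 0 < s → (0 ≤ s ^ e * a - ∑ k, s ^ d k * b k ↔ ∑ k, s ^ ((d k : ℤ) - e) * b k ≤ a) := by
    intro s hs
    rw [sum_pow_mul_eq_pow_mul_sum_zpow d e b hs.ne', ← mul_sub, mul_nonneg_iff_of_pos_left (pow_pos hs e), sub_nonneg]
  change 0 ≤ x ^ e * a - ∑ k, x ^ d k * b k at hxq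
  change 0 ≤ z ^ e * a - ∑ k, z ^ d k * b k at hzq
  change 0 ≤ y ^ e * a - ∑ k, y ^ d k * b k
  rw [hg x hx] at hxq
  rw [hg z hz] at hzq
  rw [hg y hy]
  rcases eq_or_lt_of_le (hxy.trans hyz) with hxz | hxz
  · have hyx : y = x := le_antisymm (hxz ▸ hyz) hxy
    rw [hyx]
    exact hxq
  · have hzx : 0 < z - x := sub_pos.2 hxz
    set lam : ℝ := (z - y) / (z - x) with hlam
    set mu : ℝ := (y - x) / (z - x) with hmu
    have hlam0 : 0 ≤ lam := div_nonneg (sub_nonneg.2 hyz) hzx.le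
    have hmu0 : 0 ≤ mu := div_nonneg (sub_nonneg.2 hxy) hzx.le
    have hsum : lam + mu = 1 := by
      rw [hlam, hmu, ← add_div, div_eq_one_iff_eq hzx.ne']
      ring
    have hyeq : lam • x + mu • z = y := by
      rw [smul_eq_mul, smul_eq_mul, hlam, hmu]
      field_simp
      ring
    have conv := sum_zpow_mul_le_convex_comb (fun k => (d k : ℤ) - e) b hb0 hx hz hlam0 hmu0 hsum
    rw [hyeq] at conv
    have h1 : lam * ∑ k, x ^ ((d k : ℤ) - e) * b k ≤ lam * a := mul_le_mul_of_nonneg_left hxq hlam0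
    have h2 : mu * ∑ k, z ^ ((d k : ℤ) - e) * b k ≤ mu * a := mul_le_mul_of_nonneg_left hzq hmu0
    have h3 : lam * a + mu * a = a := by rw [← add_mul, hsum, one_mul]
    linarith

/-- non-strict ray (rightward): `F(x₀) ≺ 0`, `F(a) ⪰ 0`, `0 < x₀ ≤ a ≤ b` ⇒ `F(b) ⪰ 0`. [folklore] -/
theorem posSemidef_pencil_of_negDef_left (P : Fin K → Matrix (Fin m) (Fin m) ℝ) (hP : ∀ k, (P k).PosSemidef)
    (N : Matrix (Fin m) (Fin m) ℝ) (hN : N.IsSymm) (d : Fin K → ℕ) (e : ℕ) {x₀ a b : ℝ}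
    (hx₀ : 0 < x₀) (h₀a : x₀ ≤ a) (hab : a ≤ b)
    (hneg : (x₀ ^ e • N - ∑ k, x₀ ^ d k • P k).PosDef) (hFa : (∑ k, a ^ d k • P k - a ^ e • N).PosSemidef) :
    (∑ k, b ^ d k • P k - b ^ e • N).PosSemidef := by
  have ha : 0 < a := lt_of_lt_of_le hx₀ h₀a
  have hb : 0 < b := lt_of_lt_of_le ha hab
  have hherm : (∑ k, b ^ d k • P k - b ^ e • N).IsHermitian := by
    have h := isHermitian_pivotSub P (fun k => (hP k).1) N hN d e b
    rw [← neg_sub]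
    exact h.neg
  refine PosSemidef.of_dotProduct_mulVec_nonneg hherm fun u => ?_
  rw [star_trivial, dotProduct_pencilSub_mulVec]
  by_cases hu : u = 0
  · simp [hu]
  have h0q := hneg.dotProduct_mulVec_pos hu
  have haq := hFa.dotProduct_mulVec_nonneg u
  rw [star_trivial] at h0q haq
  rw [dotProduct_pivotSub_mulVec] at h0q
  rw [dotProduct_pencilSub_mulVec] at haq
  set c : ℝ := u ⬝ᵥ (N *ᵥ u) with hc
  set w : Fin K → ℝ := fun k => u ⬝ᵥ (P k *ᵥ u) with hw
  have hw0 : ∀ k, 0 ≤ w k := fun k => by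
    have h := (hP k).dotProduct_mulVec_nonneg u
    rwa [star_trivial] at h
  have hg : ∀ s : ℝ, 0 < s → ∀ r : ℝ, (∑ k, s ^ d k * w k - s ^ e * r = s ^ e * (∑ k, s ^ ((d k : ℤ) - e) * w k - r)) := by
    intro s hs r
    rw [sum_pow_mul_eq_pow_mul_sum_zpow d e w hs.ne', mul_sub]
  change 0 < x₀ ^ e * c - ∑ k, x₀ ^ d k * w k at h0q
  change 0 ≤ ∑ k, a ^ d k * w k - a ^ e * c at haq
  change 0 ≤ ∑ k, b ^ d k * w k - b ^ e * c
  have h0' : ∑ k, x₀ ^ ((d k : ℤ) - e) * w k < c := by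
    rw [sum_pow_mul_eq_pow_mul_sum_zpow d e w hx₀.ne', ← mul_sub] at h0q
    exact sub_pos.1 ((mul_pos_iff_of_pos_left (pow_pos hx₀ e)).1 h0q)
  have ha' : c ≤ ∑ k, a ^ ((d k : ℤ) - e) * w k := by
    rw [hg a ha] at haq
    exact sub_nonneg.1 ((mul_nonneg_iff_of_pos_left (pow_pos ha e)).1 haq)
  rw [hg b hb]
  refine mul_nonneg (pow_pos hb e).le (sub_nonneg.2 ?_)
  rcases eq_or_lt_of_le hab with hab' | hab'
  · rw [← hab']; exact ha'
  · have hx₀b : x₀ < b := lt_of_le_of_lt h₀a hab'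
    have hden : 0 < b - x₀ := sub_pos.2 hx₀b
    set lam : ℝ := (b - a) / (b - x₀) with hlam
    set mu : ℝ := (a - x₀) / (b - x₀) with hmu
    have hlam0 : 0 ≤ lam := div_nonneg (sub_nonneg.2 hab) hden.le
    have hlampos : 0 < lam := div_pos (sub_pos.2 hab') hden
    have hmu0 : 0 ≤ mu := div_nonneg (sub_nonneg.2 h₀a) hden.le
    have hsum : lam + mu = 1 := by
      rw [hlam, hmu, ← add_div, div_eq_one_iff_eq hden.ne']
      ring
    have haeq : lam • x₀ + mu • b = a := by
      rw [smul_eq_mul, smul_eq_mul, hlam, hmu]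
      field_simp
      ring
    have conv := sum_zpow_mul_le_convex_comb (fun k => (d k : ℤ) - e) w hw0 hx₀ hb hlam0 hmu0 hsum
    rw [haeq] at conv
    by_contra hcon
    push Not at hcon
    have h1 : lam * ∑ k, x₀ ^ ((d k : ℤ) - e) * w k < lam * c := mul_lt_mul_of_pos_left h0' hlampos
    have h2 : mu * ∑ k, b ^ ((d k : ℤ) - e) * w k ≤ mu * c := mul_le_mul_of_nonneg_left hcon.le hmu0
    have h3 : lam * c + mu * c = c := by rw [← add_mul, hsum, one_mul]
    linarith

/-- non-strict ray (leftward): `F(x₀) ≺ 0`, `F(a) ⪰ 0`, `0 < b ≤ a ≤ x₀` ⇒ `F(b) ⪰ 0`. [folklore] -/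
theorem posSemidef_pencil_of_negDef_right (P : Fin K → Matrix (Fin m) (Fin m) ℝ) (hP : ∀ k, (P k).PosSemidef)
    (N : Matrix (Fin m) (Fin m) ℝ) (hN : N.IsSymm) (d : Fin K → ℕ) (e : ℕ) {x₀ a b : ℝ}
    (hb : 0 < b) (hba : b ≤ a) (ha₀ : a ≤ x₀)
    (hneg : (x₀ ^ e • N - ∑ k, x₀ ^ d k • P k).PosDef) (hFa : (∑ k, a ^ d k • P k - a ^ e • N).PosSemidef) :
    (∑ k, b ^ d k • P k - b ^ e • N).PosSemidef := by
  have ha : 0 < a := lt_of_lt_of_le hb hba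
  have hx₀ : 0 < x₀ := lt_of_lt_of_le ha ha₀
  have hherm : (∑ k, b ^ d k • P k - b ^ e • N).IsHermitian := by
    have h := isHermitian_pivotSub P (fun k => (hP k).1) N hN d e b
    rw [← neg_sub]
    exact h.neg
  refine PosSemidef.of_dotProduct_mulVec_nonneg hherm fun u => ?_
  rw [star_trivial, dotProduct_pencilSub_mulVec]
  by_cases hu : u = 0
  · simp [hu]
  have h0q := hneg.dotProduct_mulVec_pos hu
  have haq := hFa.dotProduct_mulVec_nonneg u
  rw [star_trivial] at h0q haq
  rw [dotProduct_pivotSub_mulVec] at h0q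
  rw [dotProduct_pencilSub_mulVec] at haq
  set c : ℝ := u ⬝ᵥ (N *ᵥ u) with hc
  set w : Fin K → ℝ := fun k => u ⬝ᵥ (P k *ᵥ u) with hw
  have hw0 : ∀ k, 0 ≤ w k := fun k => by
    have h := (hP k).dotProduct_mulVec_nonneg u
    rwa [star_trivial] at h
  have hg : ∀ s : ℝ, 0 < s → ∀ r : ℝ, (∑ k, s ^ d k * w k - s ^ e * r = s ^ e * (∑ k, s ^ ((d k : ℤ) - e) * w k - r)) := by
    intro s hs r
    rw [sum_pow_mul_eq_pow_mul_sum_zpow d e w hs.ne', mul_sub]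
  change 0 < x₀ ^ e * c - ∑ k, x₀ ^ d k * w k at h0q
  change 0 ≤ ∑ k, a ^ d k * w k - a ^ e * c at haq
  change 0 ≤ ∑ k, b ^ d k * w k - b ^ e * c
  have h0' : ∑ k, x₀ ^ ((d k : ℤ) - e) * w k < c := by
    rw [sum_pow_mul_eq_pow_mul_sum_zpow d e w hx₀.ne', ← mul_sub] at h0q
    exact sub_pos.1 ((mul_pos_iff_of_pos_left (pow_pos hx₀ e)).1 h0q)
  have ha' : c ≤ ∑ k, a ^ ((d k : ℤ) - e) * w k := by
    rw [hg a ha] at haq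
    exact sub_nonneg.1 ((mul_nonneg_iff_of_pos_left (pow_pos ha e)).1 haq)
  rw [hg b hb]
  refine mul_nonneg (pow_pos hb e).le (sub_nonneg.2 ?_)
  rcases eq_or_lt_of_le hba with hba' | hba'
  · rw [hba']; exact ha'
  · have hbx₀ : b < x₀ := lt_of_lt_of_le hba' ha₀
    have hden : 0 < x₀ - b := sub_pos.2 hbx₀
    set lam : ℝ := (x₀ - a) / (x₀ - b) with hlam
    set mu : ℝ := (a - b) / (x₀ - b) with hmu
    have hlam0 : 0 ≤ lam := div_nonneg (sub_nonneg.2 ha₀) hden.le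
    have hmu0 : 0 ≤ mu := div_nonneg (sub_nonneg.2 hba) hden.le
    have hmupos : 0 < mu := div_pos (sub_pos.2 hba') hden
    have hsum : lam + mu = 1 := by
      rw [hlam, hmu, ← add_div, div_eq_one_iff_eq hden.ne']
      ring
    have haeq : lam • b + mu • x₀ = a := by
      rw [smul_eq_mul, smul_eq_mul, hlam, hmu]
      field_simp
      ring
    have conv := sum_zpow_mul_le_convex_comb (fun k => (d k : ℤ) - e) w hw0 hb hx₀ hlam0 hmu0 hsum
    rw [haeq] at conv
    by_contra hcon
    push Not at hcon
    have h1 : mu * ∑ k, x₀ ^ ((d k : ℤ) - e) * w k < mu * c := mul_lt_mul_of_pos_left h0' hmupos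
    have h2 : lam * ∑ k, b ^ ((d k : ℤ) - e) * w k ≤ lam * c := mul_le_mul_of_nonneg_left hcon.le hlam0
    have h3 : lam * c + mu * c = c := by rw [← add_mul, hsum, one_mul]
    linarith

/-! ## 2. Roots and definiteness -/

/-- at a real point `s`, `det F(s) = 0` iff `det (s^e N − ∑ s^{dₖ}Pₖ) = 0` (the two matrices are negatives of each other). [folklore] -/
theorem det_pencilSub_eq_zero_iff (P : Fin K → Matrix (Fin m) (Fin m) ℝ) (N : Matrix (Fin m) (Fin m) ℝ) (d : Fin K → ℕ) (e : ℕ)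
    (s : ℝ) : (∑ k, s ^ d k • P k - s ^ e • N).det = 0 ↔ (s ^ e • N - ∑ k, s ^ d k • P k).det = 0 := by
  rw [← neg_sub, Matrix.det_neg, mul_eq_zero]
  exact ⟨fun h => h.resolve_left (pow_ne_zero _ (by norm_num)), fun h => Or.inr h⟩

/-- a positive semidefinite matrix that is not positive definite is singular. [folklore] -/
theorem det_eq_zero_of_posSemidef_of_not_posDef {n : Type*} [Fintype n] [DecidableEq n] {A : Matrix n n ℝ}
    (hA : A.PosSemidef) (hA' : ¬ A.PosDef) : A.det = 0 := by
  by_contra h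
  exact hA' (hA.posDef_iff_det_ne_zero.2 h)

/-- membership in the positive-root finset of `det F`. [folklore] -/
theorem mem_roots_det_pencilSub_iff (P : Fin K → Matrix (Fin m) (Fin m) ℝ) (N : Matrix (Fin m) (Fin m) ℝ)
    (d : Fin K → ℕ) (e : ℕ) (hdet : (∑ k, (X : ℝ[X]) ^ d k • (P k).map C - (X : ℝ[X]) ^ e • N.map C).det ≠ 0) (s : ℝ) :
    s ∈ (∑ k, (X : ℝ[X]) ^ d k • (P k).map C - (X : ℝ[X]) ^ e • N.map C).det.roots.toFinset ↔
      (∑ k, s ^ d k • P k - s ^ e • N).det = 0 := by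
  rw [Multiset.mem_toFinset, Polynomial.mem_roots hdet, Polynomial.IsRoot.def, eval_det_pencil_sub]

/-- if `det F` vanishes at every point of a nondegenerate interval `[p, q]`, it is the zero polynomial. [folklore] -/
theorem det_pencilSub_eq_zero_of_forall_Icc (P : Fin K → Matrix (Fin m) (Fin m) ℝ) (N : Matrix (Fin m) (Fin m) ℝ)
    (d : Fin K → ℕ) (e : ℕ) {p q : ℝ} (hpq : p < q) (h : ∀ s, p ≤ s → s ≤ q → (∑ k, s ^ d k • P k - s ^ e • N).det = 0) :
    (∑ k, (X : ℝ[X]) ^ d k • (P k).map C - (X : ℝ[X]) ^ e • N.map C).det = 0 := by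
  apply Polynomial.eq_zero_of_infinite_isRoot
  refine Set.Infinite.mono (s := Set.Icc p q) (fun s hs => ?_) (Set.Icc_infinite hpq)
  show Polynomial.IsRoot _ s
  rw [Polynomial.IsRoot.def, eval_det_pencil_sub]
  exact h s hs.1 hs.2

/-- three distinct elements of a finset of reals can be listed increasingly. [folklore] -/
theorem exists_three_lt_of_two_lt_card {s : Finset ℝ} (hs : 2 < s.card) :
    ∃ p q r, p ∈ s ∧ q ∈ s ∧ r ∈ s ∧ p < q ∧ q < r := by
  have hne : s.Nonempty := Finset.card_pos.1 (by omega)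
  set p := s.min' hne with hp
  set r := s.max' hne with hr
  have hpm : p ∈ s := s.min'_mem hne
  have hrm : r ∈ s := s.max'_mem hne
  have hpr : p < r := s.min'_lt_max'_of_card (by omega)
  have hcard : 0 < ((s.erase p).erase r).card := by
    rw [Finset.card_erase_of_mem (Finset.mem_erase.2 ⟨hpr.ne', hrm⟩), Finset.card_erase_of_mem hpm]
    omega
  obtain ⟨q, hq⟩ := Finset.card_pos.1 hcard
  rcases Finset.mem_erase.1 hq with ⟨hqr, hq'⟩
  rcases Finset.mem_erase.1 hq' with ⟨hqp, hqs⟩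
  refine ⟨p, q, r, hpm, hqs, hrm, lt_of_le_of_ne (s.min'_le q hqs) (Ne.symm hqp), lt_of_le_of_ne (s.le_max' q hqs) hqr⟩

/-! ## 3. The extreme-sheet counts -/

open scoped Classical in
/-- **BOTTOM SHEET ≤ 2.**  For `Pₖ ⪰ 0`, `N` symmetric and `det F ≢ 0` (`F = ∑ X^{dₖ}Pₖ − X^e N`), at most two positive zeros `x` of
`det F` have `F(x) ⪯ 0` (i.e. `x^e N − ∑ x^{dₖ}Pₖ ⪰ 0`). [folklore] -/
theorem card_roots_negSemidef_le_two (P : Fin K → Matrix (Fin m) (Fin m) ℝ) (hP : ∀ k, (P k).PosSemidef)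
    (N : Matrix (Fin m) (Fin m) ℝ) (hN : N.IsSymm) (d : Fin K → ℕ) (e : ℕ)
    (hdet : (∑ k, (X : ℝ[X]) ^ d k • (P k).map C - (X : ℝ[X]) ^ e • N.map C).det ≠ 0) :
    ((∑ k, (X : ℝ[X]) ^ d k • (P k).map C - (X : ℝ[X]) ^ e • N.map C).det.roots.toFinset.filter
        (fun t => 0 < t ∧ (t ^ e • N - ∑ k, t ^ d k • P k).PosSemidef)).card ≤ 2 := by
  classical
  by_contra hcon
  push Not at hcon
  obtain ⟨p, q, r, hp, hq, hr, hpq, hqr⟩ := exists_three_lt_of_two_lt_card hcon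
  simp only [Finset.mem_filter] at hp hq hr
  rw [mem_roots_det_pencilSub_iff P N d e hdet] at hp hq hr
  obtain ⟨hproot, hp0, hpN⟩ := hp
  obtain ⟨hqroot, hq0, hqN⟩ := hq
  obtain ⟨hrroot, hr0, hrN⟩ := hr
  -- `q` is not a negative-definite point
  have hqND : ¬ (q ^ e • N - ∑ k, q ^ d k • P k).PosDef := fun h =>
    h.det_pos.ne' ((det_pencilSub_eq_zero_iff P N d e q).1 hqroot)
  by_cases hleft : ∃ o : ℝ, 0 < o ∧ o < q ∧ (o ^ e • N - ∑ k, o ^ d k • P k).PosDef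
  · -- then no negative-definite point right of q; det vanishes on [q, r]
    obtain ⟨o, ho0, hoq, hoND⟩ := hleft
    refine hdet (det_pencilSub_eq_zero_of_forall_Icc P N d e hqr fun s hqs hsr => ?_)
    rw [det_pencilSub_eq_zero_iff]
    refine det_eq_zero_of_posSemidef_of_not_posDef
      (posSemidef_pivotSub_of_mem_Icc P hP N hN d e hq0 hqs hsr hqN hrN) fun hsND => hqND ?_
    exact posDef_pivotSub_of_mem_Icc P hP N hN d e ho0 hoq.le hqs hoND hsND
  · -- no negative-definite point left of q; det vanishes on [p, q]
    push Not at hleft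
    refine hdet (det_pencilSub_eq_zero_of_forall_Icc P N d e hpq fun s hps hsq => ?_)
    rw [det_pencilSub_eq_zero_iff]
    refine det_eq_zero_of_posSemidef_of_not_posDef
      (posSemidef_pivotSub_of_mem_Icc P hP N hN d e hp0 hps hsq hpN hqN) fun hsND => ?_
    rcases eq_or_lt_of_le hsq with hsq' | hsq'
    · exact hqND (hsq' ▸ hsND)
    · exact hleft s (lt_of_lt_of_le hp0 hps) hsq' hsND

open scoped Classical in
/-- **TOP SHEET ≤ 2 WHEN THE PIVOT DOMINATES SOMEWHERE.**  If moreover `F(x₀) ≺ 0` at some `x₀ > 0`, at most two positive zeros `x` of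
`det F` have `F(x) ⪰ 0`. [folklore] -/
theorem card_roots_posSemidef_le_two_of_negDef (P : Fin K → Matrix (Fin m) (Fin m) ℝ) (hP : ∀ k, (P k).PosSemidef)
    (N : Matrix (Fin m) (Fin m) ℝ) (hN : N.IsSymm) (d : Fin K → ℕ) (e : ℕ)
    (hdet : (∑ k, (X : ℝ[X]) ^ d k • (P k).map C - (X : ℝ[X]) ^ e • N.map C).det ≠ 0)
    {x₀ : ℝ} (hx₀ : 0 < x₀) (hneg : (x₀ ^ e • N - ∑ k, x₀ ^ d k • P k).PosDef) :
    ((∑ k, (X : ℝ[X]) ^ d k • (P k).map C - (X : ℝ[X]) ^ e • N.map C).det.roots.toFinset.filter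
        (fun t => 0 < t ∧ (∑ k, t ^ d k • P k - t ^ e • N).PosSemidef)).card ≤ 2 := by
  classical
  by_contra hcon
  push Not at hcon
  obtain ⟨p, q, r, hp, hq, hr, hpq, hqr⟩ := exists_three_lt_of_two_lt_card hcon
  simp only [Finset.mem_filter] at hp hq hr
  rw [mem_roots_det_pencilSub_iff P N d e hdet] at hp hq hr
  obtain ⟨hproot, hp0, hpP⟩ := hp
  obtain ⟨hqroot, hq0, hqP⟩ := hq
  obtain ⟨hrroot, hr0, hrP⟩ := hr
  have notPD : ∀ s : ℝ, (∑ k, s ^ d k • P k - s ^ e • N).det = 0 → ¬ (∑ k, s ^ d k • P k - s ^ e • N).PosDef :=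
    fun s hs h => h.det_pos.ne' hs
  have hx₀q : x₀ ≠ q := by
    intro h
    rw [h] at hneg
    exact hneg.det_pos.ne' ((det_pencilSub_eq_zero_iff P N d e q).1 hqroot)
  rcases lt_or_gt_of_ne hx₀q with hxq | hxq
  · -- x₀ < q < r : no positive-definite point in [x₀, r]; det vanishes on [q, r]
    have hnoPD : ∀ a : ℝ, x₀ ≤ a → a ≤ r → ¬ (∑ k, a ^ d k • P k - a ^ e • N).PosDef := fun a h0a har haPD =>
      notPD r hrroot (posDef_pencil_of_negDef_left P hP N hN d e hx₀ h0a har hneg haPD)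
    refine hdet (det_pencilSub_eq_zero_of_forall_Icc P N d e hqr fun s hqs hsr => ?_)
    exact det_eq_zero_of_posSemidef_of_not_posDef
      (posSemidef_pencil_of_negDef_left P hP N hN d e hx₀ hxq.le hqs hneg hqP)
      (hnoPD s (hxq.le.trans hqs) hsr)
  · -- p < q < x₀ : no positive-definite point in [p, x₀]; det vanishes on [p, q]
    have hnoPD : ∀ a : ℝ, p ≤ a → a ≤ x₀ → ¬ (∑ k, a ^ d k • P k - a ^ e • N).PosDef := fun a hpa ha0 haPD =>
      notPD p hproot (posDef_pencil_of_negDef_right P hP N hN d e hp0 hpa ha0 hneg haPD)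
    refine hdet (det_pencilSub_eq_zero_of_forall_Icc P N d e hpq fun s hps hsq => ?_)
    exact det_eq_zero_of_posSemidef_of_not_posDef
      (posSemidef_pencil_of_negDef_right P hP N hN d e (lt_of_lt_of_le hp0 hps) hsq hxq.le hneg hqP)
      (hnoPD s hps (hsq.trans hxq.le))

end Summit.ValiantsHypothesis.ValiantsHypothesis.Theorems.KPlusLogSqLaw.DefinitePivot
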